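import Summits.Ventures.Crystal3D.Theorems.StickyWulffConstantPolycrystalWulffBoundRungRelabelGeneral

/-!
# `PolycrystalWulffBound`, line `PolyDensity`: the relabelling rung with the texture's OWN CHARGES in
# the budget (crux `stmt-Ventures-19482`)

Route `StickyWulffConstant` of the venture `Summits/Ventures/Crystal3D`, second prover lane (poly-p2,
gen 11).  `rung_relabel_texture_general` (`…RungRelabelGeneral`) credits every wall between different
lattice classes with a quarter of its ordered sin-weighted facet sum (it only uses `c f g ≥ ½`).  Here the
budget carries the texture's own charges `c f g` (`Tex`: `c ≥ 0`; `≥ 1` on generic walls, `≥ ½` on twin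
walls): `rung_relabel_texture_charged` — same hypotheses, TEST

  `(1/√6)·Σ_{τ' f ≠ τ' g} Σ_{a,b} |⟪w, ν_ab⟫|·fa + Σ_{f ∈ T} cst f · Fr_{Dsc (ax f)}(f)
      ≤ Σ_{κ f ≠ κ g} (c f g / 2) · Σ_{a,b} √(1 − ⟪ν_ab, m f g⟫²)·fa`     (ordered sums),

so generic walls (charge `≥ 1`, `m f g = 0`, `sin = 1`) enter with their full area per ordered pair —
twice the credit of the general rung — which is what absorbs generic satellites (`0.504×` free area).
WHAT THIS IS NOT: the comparable-classes middle band; the crux is not claimed.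
-/

noncomputable section

open scoped BigOperators InnerProductSpace ENNReal Pointwise
open MeasureTheory Filter Set

namespace Summit.Ventures.Crystal3D.Cruxes.PolycrystalWulffBound.PolyDensity

open Summit.Ventures.Crystal3D.Theorems
open Summit.Ventures.Crystal3D.Cruxes.TextureLiminf.TexShadow (per polytope facetArea supportFn E3
  PolytopeCalculus stub_polytopeCalculus)
open Literature.MathematicalPhysics.StatisticalMechanics (fccStacking barlowStacking IsHaggSeq perimeter)

/-- **Relabelling rung with the texture's own charges in the budget** (`rung_relabel_texture_charged`).
See the module docstring. -/
theorem rung_relabel_texture_charged :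
    let Λ : Set (EuclideanSpace ℝ (Fin 3)) := Literature.MathematicalPhysics.StatisticalMechanics.fccStacking 1 (Real.sqrt (2 / 3));
    let Brl : (ℤ → ℤ) → Set (EuclideanSpace ℝ (Fin 3)) := Literature.MathematicalPhysics.StatisticalMechanics.barlowStacking 1 (Real.sqrt (2 / 3));
    let Ax : EuclideanSpace ℝ (Fin 3) → (EuclideanSpace ℝ (Fin 3) ≃ₗᵢ[ℝ] EuclideanSpace ℝ (Fin 3)) → (EuclideanSpace ℝ (Fin 3) ≃ₗᵢ[ℝ] EuclideanSpace ℝ (Fin 3)) → Prop := fun m A B => ∃ (L : EuclideanSpace ℝ (Fin 3) ≃ₗᵢ[ℝ] EuclideanSpace ℝ (Fin 3)) (s₁ s₂ : EuclideanSpace ℝ (Fin 3)) (σ σ' : ℤ → ℤ), Literature.MathematicalPhysics.StatisticalMechanics.IsHaggSeq σ ∧ Literature.MathematicalPhysics.StatisticalMechanics.IsHaggSeq σ' ∧ L (EuclideanSpace.single (2 : Fin 3) (1 : ℝ)) = m ∧ A '' Λ ⊆ (fun q => L q + s₁) '' Brl σ ∧ B '' Λ ⊆ (fun q => L q + s₂)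 '' Brl σ';
    let CoAx : (EuclideanSpace ℝ (Fin 3) ≃ₗᵢ[ℝ] EuclideanSpace ℝ (Fin 3)) → (EuclideanSpace ℝ (Fin 3) ≃ₗᵢ[ℝ] EuclideanSpace ℝ (Fin 3)) → Prop := fun A B => ∃ m, Ax m A B;
    let Φ : EuclideanSpace ℝ (Fin 3) → ℝ := fun ν => Real.sqrt 2 / 4 * ∑ᶠ w ∈ {w ∈ Λ | ‖w‖ = 1}, |⟪w, ν⟫_ℝ|;
    let Per : Set (EuclideanSpace ℝ (Fin 3)) → Set (EuclideanSpace ℝ (Fin 3)) → ℝ := fun K S => (⨆ (ξ : EuclideanSpace ℝ (Fin 3) → EuclideanSpace ℝ (Fin 3)) (_ : ContDiff ℝ 1 ξ ∧ HasCompactSupport ξ ∧ ∀ z, ξ z ∈ K), ENNReal.ofReal (∫ z in S, Literature.MathematicalPhysics.StatisticalMechanics.fieldDivergence ξ z)).toReal;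
    let ι : Set (EuclideanSpace ℝ (Fin 3)) → Set (EuclideanSpace ℝ (Fin 3)) → Set (EuclideanSpace ℝ (Fin 3)) → ℝ := fun K S₁ S₂ => (Per K S₁ + Per K S₂ - Per K (S₁ ∪ S₂)) / 2;
    let W : (EuclideanSpace ℝ (Fin 3) ≃ₗᵢ[ℝ] EuclideanSpace ℝ (Fin 3)) → Set (EuclideanSpace ℝ (Fin 3)) := fun A => {y | ∀ ν : EuclideanSpace ℝ (Fin 3), ⟪y, ν⟫_ℝ ≤ Φ (A.symm ν)};
    let Dsc : EuclideanSpace ℝ (Fin 3) → Set (EuclideanSpace ℝ (Fin 3)) := fun m => {y | ‖y‖ ≤ 1 ∧ ⟪y, m⟫_ℝ = 0};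
    let Tex : (n : ℕ) → (Fin n → Set (EuclideanSpace ℝ (Fin 3))) → (Fin n → (EuclideanSpace ℝ (Fin 3) ≃ₗᵢ[ℝ] EuclideanSpace ℝ (Fin 3))) → (Fin n → Fin n → ℝ) → (Fin n → Fin n → EuclideanSpace ℝ (Fin 3)) → Prop := fun n G A c m => (∀ f : Fin n, Literature.MathematicalPhysics.StatisticalMechanics.HasFinitePerimeter (G f) ∧ volume (G f) < ⊤) ∧ (∀ f g, f ≠ g → Disjoint (G f) (G g)) ∧ (∀ f g, f ≠ g → 0 ≤ c f g) ∧ (∀ f g, f ≠ g → ¬ CoAx (A f) (A g) → m f g = 0 ∧ 1 ≤ c f g) ∧ (∀ f g, f ≠ g → CoAx (A f) (A g) → A f '' Λ ≠ A g '' Λ → Ax (m f g) (A f) (A g) ∧ 1 / 2 ≤ c f g);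
    let En : (n : ℕ) → (Fin n → Set (EuclideanSpace ℝ (Fin 3))) → (Fin n → (EuclideanSpace ℝ (Fin 3) ≃ₗᵢ[ℝ] EuclideanSpace ℝ (Fin 3))) → (Fin n → Fin n → ℝ) → (Fin n → Fin n → EuclideanSpace ℝ (Fin 3)) → ℝ := fun n G A c m => ∑ f : Fin n, Per (W (A f)) (G f) - ∑ f, ∑ g, (if f = g then 0 else ι (W (A f)) (G f) (G g)) + ∑ f, ∑ g, (if f = g then 0 else c f g / 2 * ι (Dsc (m f g)) (G f) (G g));
    let Vol : (n : ℕ) → (Fin n → Set (EuclideanSpace ℝ (Fin 3))) → ℝ := fun n G => (volume (⋃ f : Fin n, G f)).toReal;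
    ∀ (k' : ℕ) (Hc : Fin k' → Finset ((EuclideanSpace ℝ (Fin 3)) × ℝ)) (nv : Fin k' → Fin k' → EuclideanSpace ℝ (Fin 3)),
      (∀ j, Bornology.IsBounded (polytope (Hc j))) →
      (∀ j j', j ≠ j' → Disjoint (polytope (Hc j)) (polytope (Hc j'))) →
      (∀ i j, nv j i = -nv i j) →
      (∀ j j', j ≠ j' → ‖nv j j'‖ = 1 ∧ ∃ b : ℝ,
        closure (polytope (Hc j)) ∩ closure (polytope (Hc j')) ⊆ {x | ⟪nv j j', x⟫_ℝ = b}) →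
    ∀ (n : ℕ) (G : Fin n → Set (EuclideanSpace ℝ (Fin 3)))
      (A : Fin n → (EuclideanSpace ℝ (Fin 3) ≃ₗᵢ[ℝ] EuclideanSpace ℝ (Fin 3)))
      (c : Fin n → Fin n → ℝ) (m : Fin n → Fin n → EuclideanSpace ℝ (Fin 3)),
      Tex n G A c m →
    ∀ (s : Fin n → Finset (Fin k')),
      (∀ f, G f = ⋃ j ∈ s f, polytope (Hc j)) →
      (∀ f g, f ≠ g → Disjoint (s f) (s g)) →
      (∀ j, ∃ f, j ∈ s f) →
    ∀ (κ : Fin n → ℕ), (∀ f g, κ f ≠ κ g → A f '' Λ ≠ A g '' Λ) →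
    ∀ (A' : Fin n → (EuclideanSpace ℝ (Fin 3) ≃ₗᵢ[ℝ] EuclideanSpace ℝ (Fin 3))) (τ' : Fin n → Bool)
      (T : Finset (Fin n)) (ax : Fin n → EuclideanSpace ℝ (Fin 3)) (cst : Fin n → ℝ) (m₀ u w : EuclideanSpace ℝ (Fin 3)),
      (∀ f, f ∉ T → A' f = A f) → (∀ f g, Ax m₀ (A' f) (A' g)) →
      (∀ f g, τ' f = τ' g → A' f '' Λ = A' g '' Λ) →
      ‖u‖ = 1 → ‖w‖ = 1 → ⟪u, m₀⟫_ℝ = 0 → ⟪w, m₀⟫_ℝ = 0 → ⟪w, u⟫_ℝ = 0 →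
      (∀ f, u ∈ A' f '' Λ) → (∀ f, (ℝ ∙ u)ᗮ.reflection '' (A' f '' Λ) = A' f '' Λ) →
      (∀ f ∈ T, ∀ ν : EuclideanSpace ℝ (Fin 3),
        supportFn (W (A' f)) ν ≤ supportFn (W (A f)) ν + cst f * supportFn (Dsc (ax f)) ν) →
      1 / Real.sqrt 6 * (∑ f, ∑ g, (if τ' f = τ' g then 0 else ∑ a ∈ s f, ∑ b ∈ s g,
          |⟪w, nv a b⟫_ℝ| * facetArea (closure (polytope (Hc a)) ∩ closure (polytope (Hc b))) (nv a b))) +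
        ∑ f ∈ T, cst f * (Per (Dsc (ax f)) (G f) - ∑ g, (if f = g then 0 else ι (Dsc (ax f)) (G f) (G g))) ≤
        ∑ f, ∑ g, (if κ f = κ g then 0 else c f g / 2 * ∑ a ∈ s f, ∑ b ∈ s g,
          Real.sqrt (1 - ⟪nv a b, m f g⟫_ℝ ^ 2) * facetArea (closure (polytope (Hc a)) ∩ closure (polytope (Hc b))) (nv a b)) →
    6 * (2 : ℝ) ^ ((1 : ℝ) / 3) * (Real.sqrt 2 * Vol n G) ^ ((2 : ℝ) / 3) ≤ En n G A c m := by
  intro Λ Brl Ax CoAx Φ Per ι W Dsc Tex En Vol k' Hc nv hbd hdisjQ hanti hplane n G A c m hTex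
    s hGs hsdisj hcov κ hκ A' τ' T ax cst m₀ u w hA'T hAx' hτ'1 hu hw hum hwm hwu hbond' hmir' hgap hTest
  classical
  have hTex' := hTex
  obtain ⟨hfin, hdisjG, hc0, hgen, htwin⟩ := hTex'
  have hvol : ∀ f, volume (G f) < ⊤ := fun f => (hfin f).2
  have hPC := stub_polytopeCalculus
  rcases Nat.eq_zero_or_pos n with hn | hn
  · subst hn
    show 6 * (2 : ℝ) ^ ((1 : ℝ) / 3) * (Real.sqrt 2 * (volume (⋃ f : Fin 0, G f)).toReal) ^ ((2 : ℝ) / 3) ≤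
      ∑ f : Fin 0, Per (W (A f)) (G f) - ∑ f : Fin 0, ∑ g, (if f = g then 0 else ι (W (A f)) (G f) (G g)) +
        ∑ f : Fin 0, ∑ g, (if f = g then 0 else c f g / 2 * ι (Dsc (m f g)) (G f) (G g))
    rw [iUnion_of_empty, measure_empty, ENNReal.toReal_zero, mul_zero, Real.zero_rpow (by norm_num),
      mul_zero]
    simp
  -- the relabelled texture is admissible for the law `(1, 1)` with constant wall data `m₀`
  have hTexR : Tex n G A' (fun _ _ => (1 : ℝ)) (fun _ _ => m₀) := by
    refine ⟨hfin, hdisjG, fun _ _ _ => zero_le_one, ?_, ?_⟩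
    · intro f g _ hnot
      exact absurd ⟨m₀, hAx' f g⟩ hnot
    · intro f g _ _ _
      exact ⟨hAx' f g, by norm_num⟩
  -- (1) the free-form slide rung on the relabelled frames
  have R := rung_singleAxis_texture_free k' Hc nv hbd hdisjQ hanti hplane n G A' (fun _ _ => (1 : ℝ))
    (fun _ _ => m₀) hTexR s hGs hsdisj hcov τ' hτ'1 m₀ u w hAx' hu hw hum hwm hwu hbond' hmir'
  -- abbreviations
  set fa : Fin k' → Fin k' → ℝ := fun a b =>
    facetArea (closure (polytope (Hc a)) ∩ closure (polytope (Hc b))) (nv a b) with hfa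
  have hfa0 : ∀ a b, 0 ≤ fa a b := fun a b => ENNReal.toReal_nonneg
  set Sw : ℝ := ∑ f, ∑ g, (if τ' f = τ' g then 0 else ∑ a ∈ s f, ∑ b ∈ s g, |⟪w, nv a b⟫_ℝ| * fa a b)
    with hSw
  set Z : ℝ := ∑ f, ∑ g, (if κ f = κ g then 0 else c f g / 2 * ∑ a ∈ s f, ∑ b ∈ s g,
    Real.sqrt (1 - ⟪nv a b, m f g⟫_ℝ ^ 2) * fa a b) with hZ
  set FrD : ℝ := ∑ f ∈ T, cst f * (Per (Dsc (ax f)) (G f) - ∑ g, (if f = g then 0 else ι (Dsc (ax f)) (G f) (G g)))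
    with hFrD
  -- (2) the body change `Fr(A') ≤ Fr(A) + FrD`
  have hGpoly : ∀ f, ∃ (k : ℕ) (H : Fin k → Finset (E3 × ℝ)), G f = ⋃ i, polytope (H i) := by
    intro f
    refine ⟨(s f).card, fun i => Hc ((s f).equivFin.symm i), ?_⟩
    rw [hGs f]
    ext x
    simp only [mem_iUnion]
    constructor
    · rintro ⟨j, hj, hx⟩
      exact ⟨(s f).equivFin ⟨j, hj⟩, by simpa using hx⟩
    · rintro ⟨i, hx⟩
      exact ⟨((s f).equivFin.symm i : Fin k'), ((s f).equivFin.symm i).2, hx⟩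
  have hWc : ∀ B : E3 ≃ₗᵢ[ℝ] E3, IsCompact (W B) := fun B => isCompact_cruxWulffBody B
  have hWv : ∀ B : E3 ≃ₗᵢ[ℝ] E3, Convex ℝ (W B) := fun B => convex_cruxWulffBody B
  have hW0 : ∀ B : E3 ≃ₗᵢ[ℝ] E3, (0 : E3) ∈ W B := fun B => zero_mem_cruxWulffBody B
  have hWs : ∀ B : E3 ≃ₗᵢ[ℝ] E3, -W B = W B := fun B => neg_cruxWulffBody_eq B
  have hDc : ∀ v : E3, IsCompact (Dsc v) := fun v =>
    Metric.isCompact_of_isClosed_isBounded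
      ((isClosed_le continuous_norm continuous_const).inter
        (isClosed_eq (continuous_id.inner continuous_const) continuous_const))
      (Metric.isBounded_closedBall.subset (cruxDisc_subset_closedBall v))
  have hDs : ∀ v : E3, -Dsc v = Dsc v := by
    intro v
    show -{y : E3 | ‖y‖ ≤ 1 ∧ ⟪y, v⟫_ℝ = 0} = {y : E3 | ‖y‖ ≤ 1 ∧ ⟪y, v⟫_ℝ = 0}
    ext y
    simp only [Set.mem_neg, Set.mem_setOf_eq, norm_neg, inner_neg_left, neg_eq_zero]
  have hBC := freeEnergy_bodyChange_le_add_family G hGpoly hvol hdisjG (fun f => W (A f))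
    (fun f => hWc (A f)) (fun f => hWv (A f)) (fun f => hW0 (A f)) (fun f => hWs (A f))
    (fun f => W (A' f)) (fun f => hWc (A' f)) (fun f => hWv (A' f)) (fun f => hW0 (A' f))
    (fun f => hWs (A' f)) (fun f => Dsc (ax f)) (fun f => hDc (ax f)) (fun f => convex_cruxDisc (ax f))
    (fun f => zero_mem_cruxDisc (ax f)) (fun f => hDs (ax f)) cst T
    (fun f hf => by show W (A' f) = W (A f); rw [hA'T f hf]) hgap
  -- (3) the walls of the texture pay `¼ Z` (read off `Tex`: twin walls `Ax (m f g)`, `c ≥ ½`;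
  --     generic walls `m f g = 0`, `c ≥ 1`)
  have hwall : Z ≤ ∑ f, ∑ g, (if f = g then 0 else c f g / 2 * ι (Dsc (m f g)) (G f) (G g)) := by
    rw [hZ]
    refine Finset.sum_le_sum fun f _ => ?_
    refine Finset.sum_le_sum fun g _ => ?_
    by_cases hfg : f = g
    · subst hfg; simp
    · rw [if_neg hfg]
      have hι0 : 0 ≤ ι (Dsc (m f g)) (G f) (G g) := by
        show 0 ≤ (Per (Dsc (m f g)) (G f) + Per (Dsc (m f g)) (G g) - Per (Dsc (m f g)) (G f ∪ G g)) / 2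
        have h := iota_nonneg_of_poly G hGpoly hvol hdisjG (hDc (m f g)) (convex_cruxDisc (m f g))
          (zero_mem_cruxDisc (m f g)) hfg
        exact div_nonneg h (by norm_num)
      by_cases hκfg : κ f = κ g
      · rw [if_pos hκfg]
        exact mul_nonneg (div_nonneg (hc0 f g hfg) (by norm_num)) hι0
      · rw [if_neg hκfg]
        have hne : A f '' Λ ≠ A g '' Λ := hκ f g hκfg
        -- norm of the wall datum and the charge, from `Tex`
        have hmc : (‖m f g‖ = 1 ∨ m f g = 0) ∧ 1 / 2 ≤ c f g := by
          by_cases hco : CoAx (A f) (A g)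
          · obtain ⟨hAxfg, hc⟩ := htwin f g hfg hco hne
            obtain ⟨L, -, -, -, -, -, -, hLm, -, -⟩ := hAxfg
            refine ⟨Or.inl ?_, hc⟩
            rw [← hLm, LinearIsometryEquiv.norm_map, PiLp.norm_single, norm_one]
          · obtain ⟨hm0, hc⟩ := hgen f g hfg hco
            exact ⟨Or.inr hm0, by linarith⟩
        have hιlow : ∑ a ∈ s f, ∑ b ∈ s g, Real.sqrt (1 - ⟪nv a b, m f g⟫_ℝ ^ 2) * fa a b ≤
            ι (Dsc (m f g)) (G f) (G g) := by
          have h := sinSum_le_iota_of_polytopeCalculus' hPC hmc.1 Hc nv hbd hdisjQ hanti hplane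
            (hsdisj f g hfg)
          have e1 : (⋃ j ∈ s f, polytope (Hc j)) = G f := (hGs f).symm
          have e2 : (⋃ j ∈ s g, polytope (Hc j)) = G g := (hGs g).symm
          have e3 : (⋃ j ∈ s f ∪ s g, polytope (Hc j)) = G f ∪ G g := by
            rw [Finset.set_biUnion_union, e1, e2]
          rw [e1, e2, e3] at h
          exact h
        have hZfg0 : 0 ≤ ∑ a ∈ s f, ∑ b ∈ s g, Real.sqrt (1 - ⟪nv a b, m f g⟫_ℝ ^ 2) * fa a b :=
          Finset.sum_nonneg fun a _ => Finset.sum_nonneg fun b _ =>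
            mul_nonneg (Real.sqrt_nonneg _) (hfa0 a b)
        exact mul_le_mul_of_nonneg_left hιlow (div_nonneg (hc0 f g hfg) (by norm_num))
  -- (4) assemble
  show 6 * (2 : ℝ) ^ ((1 : ℝ) / 3) * (Real.sqrt 2 * (volume (⋃ f, G f)).toReal) ^ ((2 : ℝ) / 3) ≤
    ∑ f, Per (W (A f)) (G f) - ∑ f, ∑ g, (if f = g then 0 else ι (W (A f)) (G f) (G g)) +
      ∑ f, ∑ g, (if f = g then 0 else c f g / 2 * ι (Dsc (m f g)) (G f) (G g))
  have hR : 6 * (2 : ℝ) ^ ((1 : ℝ) / 3) * (Real.sqrt 2 * (volume (⋃ f, G f)).toReal) ^ ((2 : ℝ) / 3) ≤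
      (∑ f, Per (W (A' f)) (G f) - ∑ f, ∑ g, (if f = g then 0 else ι (W (A' f)) (G f) (G g))) +
        1 / Real.sqrt 6 * Sw := R
  have hBC' : (∑ f, Per (W (A' f)) (G f) - ∑ f, ∑ g, (if f = g then 0 else ι (W (A' f)) (G f) (G g))) ≤
      (∑ f, Per (W (A f)) (G f) - ∑ f, ∑ g, (if f = g then 0 else ι (W (A f)) (G f) (G g))) + FrD := by
    have e : ∀ (B : Fin n → (E3 ≃ₗᵢ[ℝ] E3)),
        (∑ f, Per (W (B f)) (G f) - ∑ f, ∑ g, (if f = g then 0 else ι (W (B f)) (G f) (G g))) =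
        ∑ f, (per (W (B f)) (G f) - ∑ g, (if f = g then 0 else
          (per (W (B f)) (G f) + per (W (B f)) (G g) - per (W (B f)) (G f ∪ G g)) / 2)) := by
      intro B
      rw [← Finset.sum_sub_distrib]
      rfl
    have eD : FrD = ∑ f ∈ T, cst f * (per (Dsc (ax f)) (G f) -
        ∑ g, (if f = g then 0 else
          (per (Dsc (ax f)) (G f) + per (Dsc (ax f)) (G g) - per (Dsc (ax f)) (G f ∪ G g)) / 2)) := by
      rw [hFrD]
      rfl
    rw [e A', e A, eD]
    exact hBC
  have hY : 1 / Real.sqrt 6 * Sw + FrD ≤ Z := hTest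
  linarith only [hR, hBC', hY, hwall]

end Summit.Ventures.Crystal3D.Cruxes.PolycrystalWulffBound.PolyDensity

end
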